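import Literature.AlgebraicGeometry.AbelianSchemes.InfinitesimalPointDifferenceRelations
import Literature.AlgebraicGeometry.Deformation.FirstOrderPairUnitsClassShift
import Literature.AlgebraicGeometry.Deformation.BaseChangeKernelIdeal
import HarnessLib

/-!
# Homogeneity and additivity IN `H¹(𝓘)` of the class shifts `[(1 × k_j)^*c] − [(1 × k₀)^*c]` along infinitesimally close points
# (the (Mc) N3′ S-e brick K3 of cell hodgecm-mathlib, class level)

Topic `Literature/AlgebraicGeometry/AbelianSchemes`; namespace `Literature.AlgebraicGeometry.AbelianSchemes.Over`.  THEOREMS ONLY (no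
definition, no named fact, no instance, no notation, no `sorry`).  Sequel of `InfinitesimalPointDifferenceRelations` (sections and
transition functions); here the relations are passed to the classes of the `𝓘`-valued Čech cocycles `x_j` presenting
`[(1 × k_j)^*c] − [(1 × k₀)^*c] = H¹(truncExp)(q(x_j))` (pair theorem of the tree-bound `Deformation/FirstOrderPairUnitsClassShift`,
[Hartshorne2010] §6 proof of Thm. 6.4; [Hartshorne1977] III Ex. 4.4–4.5), i.e. the linearity of «lifting ↦ class in `H¹(𝓘)`» in
[MumfordAV1970] §13 (proof of the Theorem, pp. 125–127):

* §4 **`cechToH_whiskerLeft_eq_map_of_charts`** (HOMOGENEITY: `q(x₂) = H¹(μ̃)(q(x₁))` for any endomorphism `μ̃` of `𝓘` acting sectionwise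
  as `pr₂♯(μ)`, via the tree-bound `Deformation.cechToH_eq_map_of_sub_eq_mul_sub`) and **`cechToH_whiskerLeft_eq_add_of_charts`**
  (ADDITIVITY: `q(x₃) = q(x₁) + q(x₂)`, via `Deformation.cechToH_eq_add_of_pullback_g_sub_eq_add_sub`), sections-chart form over any `T`;
* §5 **`cechToH_whiskerLeft_eq_map_of_chart_sub_eq_mul_sub`** ∕ **`cechToH_whiskerLeft_eq_add_of_chart_sub_eq_add_sub`** — the same for
  `T = Spec C′` in CHART form (`ψ_j := ΓSpecIso ∘ k_j♯`, `λ ∈ C′`, scalar `(specStructureMap pr₂ λ)|_U` in the currency of the tree-bound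
  `AbelianSchemes/AbelianSchemeSmallExtensionIdealCohomology`): the `(hsmul)`∕`(hadd)` sockets of the S-e closer (Kodaira–Spencer count,
  tree-bound `AbelianSchemes/PoincareFamilyKSAssembly`).

Cell hodgecm-mathlib (D-0151 ∕ FLOOR 0), P1 (Mc) N3′ S-e, brick K3; author F0P1c-p03 (g0).  PROOF lane, generic capital.  HC_CM is proved
only modulo the 7 printed citations until rung 0 closes; nothing here is about HC.

## References
* [MumfordAV1970] D. Mumford, *Abelian Varieties* (1970): §13, proof of the Theorem, pp. 125–127.
* [Hartshorne2010] R. Hartshorne, *Deformation Theory*, GTM 257 (2010), §6 (6.1) p. 46 and proof of Thm. 6.4 (pp. 50–51).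
* [Hartshorne1977] R. Hartshorne, *Algebraic Geometry* (1977), III §4, Ex. 4.4 (b), Ex. 4.5.
* [StacksProject] The Stacks Project, Tag 01JO.
-/

universe u

open CategoryTheory CategoryTheory.Limits Opposite TopologicalSpace AlgebraicGeometry MonoidalCategory
  CartesianMonoidalCategory

noncomputable section

namespace Literature.AlgebraicGeometry.AbelianSchemes.Over

open Literature.AlgebraicGeometry.Deformation Literature.AlgebraicGeometry.Modules Literature.AlgebraicGeometry.Motives

section Forall

variable {S : Scheme.{u}} [IsAffine S] (X T₀ T : Over S) (ι₀ : T₀ ⟶ T) [IsFirstOrderThickening (X ◁ ι₀).left]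

/-! ## §4 The class statements: homogeneity and additivity of the class shifts in `H¹(𝓘)` -/

/-- **HOMOGENEITY OF THE CLASS SHIFTS.**  In the setting of `appLE_whiskerLeft_sub_eq_mul_sub_forall`, let `c` be a Čech cocycle of
units on `X ×_S X`, let `x₁, x₂` be `𝓘`-cocycles presenting the quotients `(1×k_j)^*c · ((1×k₀)^*c)⁻¹` (`idealVal x_j = r_j − 1`, the
cocycles of the pair theorem, so that `[(1×k_j)^*c] = [(1×k₀)^*c] + H¹(truncExp)(q(x_j))`), and let `μ̃ : 𝓘 → 𝓘` be ANY endomorphism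
acting sectionwise as multiplication by `pr₂♯(μ)`.  Then `q(x₂) = H¹(μ̃)(q(x₁))` in `H¹(X ×_S T, 𝓘)`: the class shift is HOMOGENEOUS in
the chart difference (tree-bound `Deformation.cechToH_eq_map_of_sub_eq_mul_sub` fed by §3). [cite: MumfordAV1970, §13 (proof of the Thm. pp. 125–127)]
[cite: Hartshorne2010, §6 proof of Thm. 6.4, pp. 50–51] [cite: Hartshorne1977, III Ex. 4.4 (b) and Ex. 4.5] -/
theorem cechToH_whiskerLeft_eq_map_of_charts (k₀ k₁ k₂ : T ⟶ X) (hk₁ : ι₀ ≫ k₁ = ι₀ ≫ k₀)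
    (hk₂ : ι₀ ≫ k₂ = ι₀ ≫ k₀) {P₂ : X.left.Opens} (hP₂ : IsAffineOpen P₂)
    (hk₀P : k₀.left ⁻¹ᵁ P₂ = ⊤) (hk₁P : k₁.left ⁻¹ᵁ P₂ = ⊤) (hk₂P : k₂.left ⁻¹ᵁ P₂ = ⊤) (μ : Γ(T.left, ⊤))
    (hψ : ∀ g : Γ(X.left, P₂),
      (k₂.left.appLE P₂ ⊤ hk₂P.ge).hom g - (k₀.left.appLE P₂ ⊤ hk₀P.ge).hom g =
        μ * ((k₁.left.appLE P₂ ⊤ hk₁P.ge).hom g - (k₀.left.appLE P₂ ⊤ hk₀P.ge).hom g))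
    (c : UnitCocycle (X ⊗ X).left)
    (μ' : idealSheafAb (X ◁ ι₀).left ⟶ idealSheafAb (X ◁ ι₀).left)
    (hμ' : ∀ (U : (X ⊗ T).left.Opens) (y : (idealSheafAb (X ◁ ι₀).left).obj.obj (op U)),
      idealVal (X ◁ ι₀).left U ((μ'.hom.app (op U)).hom y) =
        secRes (X ⊗ T).left le_top (((snd X T).left.appLE ⊤ ⊤ le_top).hom μ) * idealVal (X ◁ ι₀).left U y)
    (x₁ : cechOneCocycles (idealSheafAb (X ◁ ι₀).left)
      (UnitCocycle.mul (UnitCocycle.pullback (X ◁ k₁).left c) (UnitCocycle.inv (UnitCocycle.pullback (X ◁ k₀).left c))).U)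
    (x₂ : cechOneCocycles (idealSheafAb (X ◁ ι₀).left)
      (UnitCocycle.mul (UnitCocycle.pullback (X ◁ k₂).left c) (UnitCocycle.inv (UnitCocycle.pullback (X ◁ k₀).left c))).U)
    (hx₁ : ∀ a b, idealVal (X ◁ ι₀).left _ ((x₁ : CechOneCochain (idealSheafAb (X ◁ ι₀).left) _) a b) =
      (UnitCocycle.mul (UnitCocycle.pullback (X ◁ k₁).left c) (UnitCocycle.inv (UnitCocycle.pullback (X ◁ k₀).left c))).g
        a b _ inf_le_left inf_le_right - 1)
    (hx₂ : ∀ a b, idealVal (X ◁ ι₀).left _ ((x₂ : CechOneCochain (idealSheafAb (X ◁ ι₀).left) _) a b) =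
      (UnitCocycle.mul (UnitCocycle.pullback (X ◁ k₂).left c) (UnitCocycle.inv (UnitCocycle.pullback (X ◁ k₀).left c))).g
        a b _ inf_le_left inf_le_right - 1) :
    cechToH (idealSheafAb (X ◁ ι₀).left) _
        (UnitCocycle.mul (UnitCocycle.pullback (X ◁ k₂).left c)
          (UnitCocycle.inv (UnitCocycle.pullback (X ◁ k₀).left c))).iSup_U_eq_top x₂ =
      Sheaf.H.map μ' 1 (cechToH (idealSheafAb (X ◁ ι₀).left) _
        (UnitCocycle.mul (UnitCocycle.pullback (X ◁ k₁).left c)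
          (UnitCocycle.inv (UnitCocycle.pullback (X ◁ k₀).left c))).iSup_U_eq_top x₁) :=
  cechToH_eq_map_of_sub_eq_mul_sub (X ◁ ι₀).left (X ◁ k₀).left (X ◁ k₁).left (X ◁ k₂).left c _ μ' hμ'
    (fun a b V h₁a h₁b h₂a h₂b h₂'a h₂'b =>
      pullback_whiskerLeft_g_sub_eq_mul_sub X T₀ T ι₀ k₀ k₁ k₂ hk₁ hk₂ hP₂ hk₀P hk₁P hk₂P μ hψ c a b V
        h₁a h₁b h₂a h₂b h₂'a h₂'b)
    x₁ x₂ hx₁ hx₂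

/-- **ADDITIVITY OF THE CLASS SHIFTS.**  In the setting of `appLE_whiskerLeft_sub_eq_add_sub_forall`, let `c` be a Čech cocycle of
units on `X ×_S X` and `x₁, x₂, x₃` the `𝓘`-cocycles presenting `(1×k_j)^*c · ((1×k₀)^*c)⁻¹` as in the pair theorem.  Then
`q(x₃) = q(x₁) + q(x₂)` in `H¹(X ×_S T, 𝓘)`: the class shift is ADDITIVE in the chart difference
(`Deformation.cechToH_eq_add_of_pullback_g_sub_eq_add_sub` fed by §3). [cite: MumfordAV1970, §13 (proof of the Thm. pp. 125–127)]
[cite: Hartshorne2010, §6 proof of Thm. 6.4, pp. 50–51] [cite: Hartshorne1977, III Ex. 4.4 (b) and Ex. 4.5] -/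
theorem cechToH_whiskerLeft_eq_add_of_charts (k₀ k₁ k₂ k₃ : T ⟶ X) (hk₁ : ι₀ ≫ k₁ = ι₀ ≫ k₀)
    (hk₂ : ι₀ ≫ k₂ = ι₀ ≫ k₀) (hk₃ : ι₀ ≫ k₃ = ι₀ ≫ k₀) {P₂ : X.left.Opens} (hP₂ : IsAffineOpen P₂)
    (hk₀P : k₀.left ⁻¹ᵁ P₂ = ⊤) (hk₁P : k₁.left ⁻¹ᵁ P₂ = ⊤) (hk₂P : k₂.left ⁻¹ᵁ P₂ = ⊤) (hk₃P : k₃.left ⁻¹ᵁ P₂ = ⊤)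
    (hψ : ∀ g : Γ(X.left, P₂),
      (k₃.left.appLE P₂ ⊤ hk₃P.ge).hom g - (k₀.left.appLE P₂ ⊤ hk₀P.ge).hom g =
        ((k₁.left.appLE P₂ ⊤ hk₁P.ge).hom g - (k₀.left.appLE P₂ ⊤ hk₀P.ge).hom g) +
          ((k₂.left.appLE P₂ ⊤ hk₂P.ge).hom g - (k₀.left.appLE P₂ ⊤ hk₀P.ge).hom g))
    (c : UnitCocycle (X ⊗ X).left)
    (x₁ : cechOneCocycles (idealSheafAb (X ◁ ι₀).left)
      (UnitCocycle.mul (UnitCocycle.pullback (X ◁ k₁).left c) (UnitCocycle.inv (UnitCocycle.pullback (X ◁ k₀).left c))).U)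
    (x₂ : cechOneCocycles (idealSheafAb (X ◁ ι₀).left)
      (UnitCocycle.mul (UnitCocycle.pullback (X ◁ k₂).left c) (UnitCocycle.inv (UnitCocycle.pullback (X ◁ k₀).left c))).U)
    (x₃ : cechOneCocycles (idealSheafAb (X ◁ ι₀).left)
      (UnitCocycle.mul (UnitCocycle.pullback (X ◁ k₃).left c) (UnitCocycle.inv (UnitCocycle.pullback (X ◁ k₀).left c))).U)
    (hx₁ : ∀ a b, idealVal (X ◁ ι₀).left _ ((x₁ : CechOneCochain (idealSheafAb (X ◁ ι₀).left) _) a b) =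
      (UnitCocycle.mul (UnitCocycle.pullback (X ◁ k₁).left c) (UnitCocycle.inv (UnitCocycle.pullback (X ◁ k₀).left c))).g
        a b _ inf_le_left inf_le_right - 1)
    (hx₂ : ∀ a b, idealVal (X ◁ ι₀).left _ ((x₂ : CechOneCochain (idealSheafAb (X ◁ ι₀).left) _) a b) =
      (UnitCocycle.mul (UnitCocycle.pullback (X ◁ k₂).left c) (UnitCocycle.inv (UnitCocycle.pullback (X ◁ k₀).left c))).g
        a b _ inf_le_left inf_le_right - 1)
    (hx₃ : ∀ a b, idealVal (X ◁ ι₀).left _ ((x₃ : CechOneCochain (idealSheafAb (X ◁ ι₀).left) _) a b) =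
      (UnitCocycle.mul (UnitCocycle.pullback (X ◁ k₃).left c) (UnitCocycle.inv (UnitCocycle.pullback (X ◁ k₀).left c))).g
        a b _ inf_le_left inf_le_right - 1) :
    cechToH (idealSheafAb (X ◁ ι₀).left) _
        (UnitCocycle.mul (UnitCocycle.pullback (X ◁ k₃).left c)
          (UnitCocycle.inv (UnitCocycle.pullback (X ◁ k₀).left c))).iSup_U_eq_top x₃ =
      cechToH (idealSheafAb (X ◁ ι₀).left) _
          (UnitCocycle.mul (UnitCocycle.pullback (X ◁ k₁).left c)
            (UnitCocycle.inv (UnitCocycle.pullback (X ◁ k₀).left c))).iSup_U_eq_top x₁ +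
        cechToH (idealSheafAb (X ◁ ι₀).left) _
          (UnitCocycle.mul (UnitCocycle.pullback (X ◁ k₂).left c)
            (UnitCocycle.inv (UnitCocycle.pullback (X ◁ k₀).left c))).iSup_U_eq_top x₂ :=
  cechToH_eq_add_of_pullback_g_sub_eq_add_sub (X ◁ ι₀).left (X ◁ k₀).left (X ◁ k₁).left (X ◁ k₂).left (X ◁ k₃).left c
    (pullback_whiskerLeft_g_sub_eq_add_sub X T₀ T ι₀ k₀ k₁ k₂ k₃ hk₁ hk₂ hk₃ hP₂ hk₀P hk₁P hk₂P hk₃P hψ c)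
    x₁ x₂ x₃ hx₁ hx₂ hx₃

end Forall

/-! ## §5 Chart form over an affine test scheme `T = Spec C′` (the sockets of the S-e closer) -/

/-- Transport of the chart relation through `Γ(Spec C′, ⊤) ≅ C′`: `ΓSpecIso⁻¹ (ΓSpecIso y) = y`. [cite: StacksProject, Tag 01JO] -/
private theorem ΓSpecIso_inv_hom_apply' {S : Scheme.{u}} {C' : Type u} [CommRing C'] (c' : Spec (.of C') ⟶ S)
    (y : Γ((Over.mk c').left, ⊤)) :
    (Scheme.ΓSpecIso (.of C')).inv.hom
      (CommRingCat.Hom.hom (R := Γ((Over.mk c').left, ⊤)) (Scheme.ΓSpecIso (.of C')).hom y) = y :=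
  congrArg (fun φ : Γ(Spec (.of C'), ⊤) ⟶ Γ(Spec (.of C'), ⊤) => φ.hom y) (Scheme.ΓSpecIso (.of C')).hom_inv_id

section Charts

variable {S : Scheme.{u}} [IsAffine S] (X T₀ : Over S) {C' : Type u} [CommRing C'] (c' : Spec (.of C') ⟶ S)
  (ι₀ : T₀ ⟶ Over.mk c') [IsFirstOrderThickening (X ◁ ι₀).left]

omit [IsAffine S] [IsFirstOrderThickening (X ◁ ι₀).left] in
/-- The global function `pr₂♯(λ)` on `X ×_S Spec C′` in the two currencies: the structure-map form
`(specStructureMap pr₂ λ)|_U` (tree `Deformation.specStructureMap`) equals `(pr₂.appLE ⊤ ⊤ (ΓSpecIso⁻¹ λ))|_U`.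
[cite: Hartshorne2010, §6 (6.1), p. 46] -/
theorem map_specStructureMap_snd_eq (lam : C') (U : (X ⊗ Over.mk c').left.Opens) :
    (X ⊗ Over.mk c').left.presheaf.map (homOfLE (le_top : U ≤ ⊤)).op
        (specStructureMap (pullback.snd X.hom c') lam) =
      secRes (X ⊗ Over.mk c').left (le_top : U ≤ ⊤)
        (((snd X (Over.mk c')).left.appLE ⊤ ⊤ le_top).hom ((Scheme.ΓSpecIso (.of C')).inv.hom lam)) := by
  rw [specStructureMap_apply]
  change ((pullback.snd X.hom c').app ⊤ ≫ (X ⊗ Over.mk c').left.presheaf.map (homOfLE (le_top : U ≤ ⊤)).op)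
      ((Scheme.ΓSpecIso (.of C')).inv.hom lam) =
    ((snd X (Over.mk c')).left.appLE ⊤ ⊤ le_top ≫ (X ⊗ Over.mk c').left.presheaf.map (homOfLE (le_top : U ≤ ⊤)).op)
      ((Scheme.ΓSpecIso (.of C')).inv.hom lam)
  rw [Scheme.Hom.appLE_map]
  rfl

/-- **(K3-hom) HOMOGENEITY OF THE CLASS SHIFTS, CHART FORM.**  `S` affine, `ι₀ : T₀ → Spec C′` over `S` with `1_X × ι₀` a first-order
thickening, `k₀ k₁ k₂ : Spec C′ → X` over `S` agreeing on `T₀`, landing in the affine open `P₂` (`k_j⁻¹P₂ = ⊤`), charts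
`ψ_j := ΓSpecIso ∘ k_j♯ : Γ(X, P₂) → C′` with `ψ₂ − ψ₀ = λ · (ψ₁ − ψ₀)` (`λ ∈ C′`); `c` any Čech cocycle of units on `X ×_S X`, `x₁, x₂` the
`𝓘`-cocycles presenting `(1×k_j)^*c · ((1×k₀)^*c)⁻¹`, and `μ : 𝓘 → 𝓘` any endomorphism acting sectionwise as multiplication by
`(specStructureMap pr₂ λ)|_U` (the currency of the tree-bound `AbelianSchemes/AbelianSchemeSmallExtensionIdealCohomology`).  Then
`q(x₂) = H¹(μ)(q(x₁))`. [cite: MumfordAV1970, §13 (proof of the Thm. pp. 125–127)] [cite: Hartshorne2010, §6 proof of Thm. 6.4, pp. 50–51]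
[cite: Hartshorne1977, III Ex. 4.4 (b) and Ex. 4.5] -/
theorem cechToH_whiskerLeft_eq_map_of_chart_sub_eq_mul_sub (k₀ k₁ k₂ : Over.mk c' ⟶ X) (hk₁ : ι₀ ≫ k₁ = ι₀ ≫ k₀)
    (hk₂ : ι₀ ≫ k₂ = ι₀ ≫ k₀) {P₂ : X.left.Opens} (hP₂ : IsAffineOpen P₂)
    (hk₀P : k₀.left ⁻¹ᵁ P₂ = ⊤) (hk₁P : k₁.left ⁻¹ᵁ P₂ = ⊤) (hk₂P : k₂.left ⁻¹ᵁ P₂ = ⊤) (lam : C')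
    (hψ : ∀ g : Γ(X.left, P₂),
      (k₂.left.appLE P₂ ⊤ hk₂P.ge ≫ (Scheme.ΓSpecIso (.of C')).hom).hom g -
          (k₀.left.appLE P₂ ⊤ hk₀P.ge ≫ (Scheme.ΓSpecIso (.of C')).hom).hom g =
        lam * ((k₁.left.appLE P₂ ⊤ hk₁P.ge ≫ (Scheme.ΓSpecIso (.of C')).hom).hom g -
          (k₀.left.appLE P₂ ⊤ hk₀P.ge ≫ (Scheme.ΓSpecIso (.of C')).hom).hom g))
    (c : UnitCocycle (X ⊗ X).left)
    (μ : idealSheafAb (X ◁ ι₀).left ⟶ idealSheafAb (X ◁ ι₀).left)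
    (hμ : ∀ (U : (X ⊗ Over.mk c').left.Opens) (y : (idealSheafAb (X ◁ ι₀).left).obj.obj (op U)),
      idealVal (X ◁ ι₀).left U ((μ.hom.app (op U)).hom y) =
        (X ⊗ Over.mk c').left.presheaf.map (homOfLE (le_top : U ≤ ⊤)).op
            (specStructureMap (pullback.snd X.hom c') lam) * idealVal (X ◁ ι₀).left U y)
    (x₁ : cechOneCocycles (idealSheafAb (X ◁ ι₀).left)
      (UnitCocycle.mul (UnitCocycle.pullback (X ◁ k₁).left c) (UnitCocycle.inv (UnitCocycle.pullback (X ◁ k₀).left c))).U)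
    (x₂ : cechOneCocycles (idealSheafAb (X ◁ ι₀).left)
      (UnitCocycle.mul (UnitCocycle.pullback (X ◁ k₂).left c) (UnitCocycle.inv (UnitCocycle.pullback (X ◁ k₀).left c))).U)
    (hx₁ : ∀ a b, idealVal (X ◁ ι₀).left _ ((x₁ : CechOneCochain (idealSheafAb (X ◁ ι₀).left) _) a b) =
      (UnitCocycle.mul (UnitCocycle.pullback (X ◁ k₁).left c) (UnitCocycle.inv (UnitCocycle.pullback (X ◁ k₀).left c))).g
        a b _ inf_le_left inf_le_right - 1)
    (hx₂ : ∀ a b, idealVal (X ◁ ι₀).left _ ((x₂ : CechOneCochain (idealSheafAb (X ◁ ι₀).left) _) a b) =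
      (UnitCocycle.mul (UnitCocycle.pullback (X ◁ k₂).left c) (UnitCocycle.inv (UnitCocycle.pullback (X ◁ k₀).left c))).g
        a b _ inf_le_left inf_le_right - 1) :
    cechToH (idealSheafAb (X ◁ ι₀).left) _
        (UnitCocycle.mul (UnitCocycle.pullback (X ◁ k₂).left c)
          (UnitCocycle.inv (UnitCocycle.pullback (X ◁ k₀).left c))).iSup_U_eq_top x₂ =
      Sheaf.H.map μ 1 (cechToH (idealSheafAb (X ◁ ι₀).left) _
        (UnitCocycle.mul (UnitCocycle.pullback (X ◁ k₁).left c)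
          (UnitCocycle.inv (UnitCocycle.pullback (X ◁ k₀).left c))).iSup_U_eq_top x₁) := by
  refine cechToH_whiskerLeft_eq_map_of_charts X T₀ (Over.mk c') ι₀ k₀ k₁ k₂ hk₁ hk₂ hP₂ hk₀P hk₁P hk₂P
    (show Γ((Over.mk c').left, ⊤) from (Scheme.ΓSpecIso (.of C')).inv.hom lam) (fun g => ?_) c μ (fun U y => ?_)
    x₁ x₂ hx₁ hx₂
  · have e := congrArg (Scheme.ΓSpecIso (.of C')).inv.hom (hψ g)
    simp only [map_sub, map_mul, CommRingCat.hom_comp, RingHom.comp_apply] at e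
    rw [ΓSpecIso_inv_hom_apply' c' ((k₂.left.appLE P₂ ⊤ hk₂P.ge).hom g),
      ΓSpecIso_inv_hom_apply' c' ((k₁.left.appLE P₂ ⊤ hk₁P.ge).hom g),
      ΓSpecIso_inv_hom_apply' c' ((k₀.left.appLE P₂ ⊤ hk₀P.ge).hom g)] at e
    exact e
  · rw [hμ U y, map_specStructureMap_snd_eq X c' lam U]

/-- **(K3-add) ADDITIVITY OF THE CLASS SHIFTS, CHART FORM.**  Same setting with four points `k₀ … k₃ : Spec C′ → X` over `S` agreeing on
`T₀`, landing in the affine `P₂`, and charts with `ψ₃ − ψ₀ = (ψ₁ − ψ₀) + (ψ₂ − ψ₀)`; `c` any Čech cocycle of units on `X ×_S X`, `x_j` the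
`𝓘`-cocycles presenting `(1×k_j)^*c · ((1×k₀)^*c)⁻¹`.  Then `q(x₃) = q(x₁) + q(x₂)` in `H¹(X ×_S Spec C′, 𝓘)`.
[cite: MumfordAV1970, §13 (proof of the Thm. pp. 125–127)] [cite: Hartshorne2010, §6 proof of Thm. 6.4, pp. 50–51]
[cite: Hartshorne1977, III Ex. 4.4 (b) and Ex. 4.5] -/
theorem cechToH_whiskerLeft_eq_add_of_chart_sub_eq_add_sub (k₀ k₁ k₂ k₃ : Over.mk c' ⟶ X) (hk₁ : ι₀ ≫ k₁ = ι₀ ≫ k₀)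
    (hk₂ : ι₀ ≫ k₂ = ι₀ ≫ k₀) (hk₃ : ι₀ ≫ k₃ = ι₀ ≫ k₀) {P₂ : X.left.Opens} (hP₂ : IsAffineOpen P₂)
    (hk₀P : k₀.left ⁻¹ᵁ P₂ = ⊤) (hk₁P : k₁.left ⁻¹ᵁ P₂ = ⊤) (hk₂P : k₂.left ⁻¹ᵁ P₂ = ⊤) (hk₃P : k₃.left ⁻¹ᵁ P₂ = ⊤)
    (hψ : ∀ g : Γ(X.left, P₂),
      (k₃.left.appLE P₂ ⊤ hk₃P.ge ≫ (Scheme.ΓSpecIso (.of C')).hom).hom g -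
          (k₀.left.appLE P₂ ⊤ hk₀P.ge ≫ (Scheme.ΓSpecIso (.of C')).hom).hom g =
        ((k₁.left.appLE P₂ ⊤ hk₁P.ge ≫ (Scheme.ΓSpecIso (.of C')).hom).hom g -
            (k₀.left.appLE P₂ ⊤ hk₀P.ge ≫ (Scheme.ΓSpecIso (.of C')).hom).hom g) +
          ((k₂.left.appLE P₂ ⊤ hk₂P.ge ≫ (Scheme.ΓSpecIso (.of C')).hom).hom g -
            (k₀.left.appLE P₂ ⊤ hk₀P.ge ≫ (Scheme.ΓSpecIso (.of C')).hom).hom g))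
    (c : UnitCocycle (X ⊗ X).left)
    (x₁ : cechOneCocycles (idealSheafAb (X ◁ ι₀).left)
      (UnitCocycle.mul (UnitCocycle.pullback (X ◁ k₁).left c) (UnitCocycle.inv (UnitCocycle.pullback (X ◁ k₀).left c))).U)
    (x₂ : cechOneCocycles (idealSheafAb (X ◁ ι₀).left)
      (UnitCocycle.mul (UnitCocycle.pullback (X ◁ k₂).left c) (UnitCocycle.inv (UnitCocycle.pullback (X ◁ k₀).left c))).U)
    (x₃ : cechOneCocycles (idealSheafAb (X ◁ ι₀).left)
      (UnitCocycle.mul (UnitCocycle.pullback (X ◁ k₃).left c) (UnitCocycle.inv (UnitCocycle.pullback (X ◁ k₀).left c))).U)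
    (hx₁ : ∀ a b, idealVal (X ◁ ι₀).left _ ((x₁ : CechOneCochain (idealSheafAb (X ◁ ι₀).left) _) a b) =
      (UnitCocycle.mul (UnitCocycle.pullback (X ◁ k₁).left c) (UnitCocycle.inv (UnitCocycle.pullback (X ◁ k₀).left c))).g
        a b _ inf_le_left inf_le_right - 1)
    (hx₂ : ∀ a b, idealVal (X ◁ ι₀).left _ ((x₂ : CechOneCochain (idealSheafAb (X ◁ ι₀).left) _) a b) =
      (UnitCocycle.mul (UnitCocycle.pullback (X ◁ k₂).left c) (UnitCocycle.inv (UnitCocycle.pullback (X ◁ k₀).left c))).g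
        a b _ inf_le_left inf_le_right - 1)
    (hx₃ : ∀ a b, idealVal (X ◁ ι₀).left _ ((x₃ : CechOneCochain (idealSheafAb (X ◁ ι₀).left) _) a b) =
      (UnitCocycle.mul (UnitCocycle.pullback (X ◁ k₃).left c) (UnitCocycle.inv (UnitCocycle.pullback (X ◁ k₀).left c))).g
        a b _ inf_le_left inf_le_right - 1) :
    cechToH (idealSheafAb (X ◁ ι₀).left) _
        (UnitCocycle.mul (UnitCocycle.pullback (X ◁ k₃).left c)
          (UnitCocycle.inv (UnitCocycle.pullback (X ◁ k₀).left c))).iSup_U_eq_top x₃ =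
      cechToH (idealSheafAb (X ◁ ι₀).left) _
          (UnitCocycle.mul (UnitCocycle.pullback (X ◁ k₁).left c)
            (UnitCocycle.inv (UnitCocycle.pullback (X ◁ k₀).left c))).iSup_U_eq_top x₁ +
        cechToH (idealSheafAb (X ◁ ι₀).left) _
          (UnitCocycle.mul (UnitCocycle.pullback (X ◁ k₂).left c)
            (UnitCocycle.inv (UnitCocycle.pullback (X ◁ k₀).left c))).iSup_U_eq_top x₂ := by
  refine cechToH_whiskerLeft_eq_add_of_charts X T₀ (Over.mk c') ι₀ k₀ k₁ k₂ k₃ hk₁ hk₂ hk₃ hP₂ hk₀P hk₁P hk₂P hk₃P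
    (fun g => ?_) c x₁ x₂ x₃ hx₁ hx₂ hx₃
  have e := congrArg (Scheme.ΓSpecIso (.of C')).inv.hom (hψ g)
  simp only [map_sub, map_add, CommRingCat.hom_comp, RingHom.comp_apply] at e
  rw [ΓSpecIso_inv_hom_apply' c' ((k₃.left.appLE P₂ ⊤ hk₃P.ge).hom g),
    ΓSpecIso_inv_hom_apply' c' ((k₂.left.appLE P₂ ⊤ hk₂P.ge).hom g),
    ΓSpecIso_inv_hom_apply' c' ((k₁.left.appLE P₂ ⊤ hk₁P.ge).hom g),
    ΓSpecIso_inv_hom_apply' c' ((k₀.left.appLE P₂ ⊤ hk₀P.ge).hom g)] at e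
  exact e

end Charts

end Literature.AlgebraicGeometry.AbelianSchemes.Over

end
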